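import Literature.IUT.HodgeArakelov.GaloisPairCyclotomesCompatibleOfHgal
import Literature.IUT.HodgeArakelov.GaloisPairCyclotomesCor111GenuineCompatible
import Literature.IUT.HodgeArakelov.ModelCyclotomesZHat
import HarnessLib

/-!
# [IUTchII] Cor. 1.11: the functor `ℛ → ℱ` with ALL FOUR inputs genuine, FROM (HGAL) ALONE — the node-level capstone
# (abc-iut-w5-d145's `…_of_compatible(_ownField)` ∘ `nonempty_galCorPiXInput_familyLim_of_hgalois`'s dictionary)

S. Mochizuki, *Inter-universal Teichmüller theory II*, §1, Cor. 1.11, kurims manuscript (Dec. 2020) p. 49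
[claim: Mochizuki2012, status: disputed] (IUTchII §1 Cor 1.11, kurims p.49); Cor. 1.10 p. 47; [AbsTopIII] Cor. 1.10 pp. 41–44
((HGAL), the FACT-class input of record, ruling C-R25); [EtTh] Cor. 2.18 (i) p. 60 (F-0620), §1 pp. 12–13 (the class-R origin
clauses `IsEtThOrigin`, `hYcl`, `IsTateOrigin` of abc-iut-L2; never asserted). abc-iut cell, layer L6, node `IUTchII:Cor1.11`;
seat abc-iut-w4-d030 (gen 5) — lineage of `GaloisPairCyclotomesCor111Genuine` (p431925, the ∃-assembly at genuine inputs)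
and of the `EtaleLevels` natural system (bridge B8 part 5). PROOF-ONLY: 0 definitions, no `Prop`-valued fact, nothing restated.

STATE OF RECORD. abc-iut-w5-d145's `exists_cor111FunctorCor110_familyLim_multiradiallyDefined_of_compatible(_ownField)`
(p434854) gives the Cor. 1.11 functor over the GENUINE monoids / twist / rigidity input / Cor. 1.10 family MODULO the typed
residual (C′) «every comparison `μ_Ẑ(Π^tp_{X̲̲}/Δ) ⥲ (l·Δ_Θ)(𝕄_*)` intertwines `μ_Ẑ(quotMap γ)` with `ρ_A(γ)`» (G-w5d145-2);
abc-iut-w5-d145 (gen 5) `nonempty_galCorPiXInput_familyLim_of_hgalois` (p452356, over abc-iut-w5-d169's `hcyc_of_hgal`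
p450689) reduced the `Π`-side INPUT to (HGAL) alone, but no consumer at the level of the FUNCTOR existed. THIS FILE closes
that last inch:

* `EtaleLevels.compatible_of_hgalois` — (HGAL) «∀ α ∃ τ ∈ G_{ℚ_p}, aug(α x) = τ·aug(x)·τ⁻¹» + the class-R clauses + `hq`
  + F-0620 at every level ⟹ (C′) AT EVERY `γ`, FOR EVERY comparison `c` and EVERY Ex. 1.8 interface `A`
  (= `compatible_of_galois` ∘ `coeffAut_eq_galMuN_of_thetaMod_natural` ∘ `thetaMod_natural_of_hgal`);
* **`EtaleLevels.exists_cor111FunctorCor110_familyLim_multiradiallyDefined_of_hgalois`** (arbitrary MLF `k` with a model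
  identification `ε`) and **`…_of_hgalois_ownField`** (`k := K`, `ε := galoisEpsilon` — no model identification): the
  [IUTchII] Cor. 1.11 functor `ℛ → ℱ` EXISTS and is multiradially defined, residual BY NAME = {F-0620 `Cor218_i` at every
  level, (HGAL), (H1) `hΔ`, (H2) `hq` (Π/Δ ≅ G_K), `IsQuotientMap toTheta`, `IsEtThOrigin`, `hYcl`, `IsTateOrigin`, `Prop15iii`,
  `hZ`} — i.e. beyond printed/class-R inputs EXACTLY ONE FACT-class anabelian input (HGAL) = [AbsTopIII] Cor. 1.10;
* **`…_of_hgalois_ownField_origin`** — the same with the binder `hZ` («(l·Δ_Θ)/thetaKer ≅ Ẑ», G-w4d021-1) SUPPLIED at the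
  origin by abc-iut-L2-d1's `ModelCyclotomes.nonempty_lDeltaQuot_rigidData_mulEquiv_zHat … hO hYcl` (one binder fewer; the
  pattern of abc-iut-w4-d008's `ModelDef11OutputOfOrigin`).
Nothing here asserts anything of [IUTchII], [EtTh] or [AbsTopIII]; (HGAL) and the class-R clauses stay hypotheses BY NAME;
reductions between residuals are not a discharge of (HGAL); no side is taken on [IUTchIII] Cor. 3.12; typed ≠ proved.
-/

noncomputable section

open Topology

namespace Literature.IUT.HodgeArakelov

open CategoryTheory
open Literature.AnabelianGeometry.AbsoluteAnabelian

namespace EtaleLevels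

open Literature.AnabelianGeometry.EtaleTheta Literature.AnabelianGeometry.SemiGraphs
open Literature.AnabelianGeometry.EtaleTheta.ThetaSetting
open scoped Literature.AnabelianGeometry.EtaleTheta

variable {p : ℕ} [Fact p.Prime] {D : Literature.AnabelianGeometry.EtaleTheta.ThetaSetting p}
  {E : D.EtaleThetaData} {l : ℕ} (C : E.DoubleUnderline l) (hC : D.Compat) (hS : D.Sec2Hyps)
  (hl : l.Prime) (hp2 : p ≠ 2) (hpl : p ≠ l) (hζ : ∃ ζ : D.K, IsPrimitiveRoot ζ (4 * l))
  (mods : ∀ M : ℕ+, D.CyclotomeMod l M)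
  (f : contCocycles D.toTheta D.DeltaTheta C.GtpYdduu) (hf : f ∈ C.rootCocycles hC)
  (hmods : ∀ (M M' : ℕ+) (h : (M : ℕ) ∣ (M' : ℕ)) (x : D.lDeltaTheta l),
    MuN.red p M M' h ((mods M').red x) = (mods M).red x)
  (h15 : Literature.AnabelianGeometry.EtaleTheta.ThetaSetting.Prop15iii E hC) (L : C.CuspLabels)
  (hZ : ∀ M : ℕ+, Nonempty (ModelCyclotomes.lDeltaQuot (C.rigidData (mods M) hC hS h15 L) ≃*
    Literature.IUT.HodgeTheaters.ZHat))
  (h218i : ∀ M : ℕ+, (levelRigid C hC hS mods h15 L M).Cor218_i)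
  [CompactSpace (setting C hC hS hl hp2 hpl hζ mods f hf).Gk]
  (hO : D.IsEtThOrigin)
  (hYcl : (D.DtpY.map D.toHat.toMonoidHom).topologicalClosure ≤
    D.DtpY.map D.toHat.toMonoidHom ⊔ (⁅⁅D.DeltaHat, D.DeltaHat⁆, D.DeltaHat⁆).topologicalClosure)
  (hT : D.IsTateOrigin) (hqΘ : IsQuotientMap D.toTheta)
  (hHGAL : ∀ α : (EtaleThetaDataOfSetting.Pi C) ≃ₜ* (EtaleThetaDataOfSetting.Pi C), ∃ τ : GQp p,
    ∀ x : EtaleThetaDataOfSetting.Pi C,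
      EtaleThetaDataOfSetting.aug C (α x) = τ * EtaleThetaDataOfSetting.aug C x * τ⁻¹)

/-! ## (C′) from (HGAL), at every `γ`, for every comparison and every Ex. 1.8 interface -/

include hO hYcl hT hqΘ hHGAL in
/-- **(HGAL) ⟹ (C′)**: for the genuine data of a `ThetaSetting` at an [EtTh] origin (class-R clauses `IsEtThOrigin`, `hYcl`,
`IsTateOrigin`, `IsQuotientMap toTheta`, BY NAME), under F-0620 at every level, if every topological automorphism of `Π^tp_{X̲̲}`
lies over an inner automorphism of `G_{ℚ_p}` restricted to `G_K` ((HGAL), [AbsTopIII] Cor. 1.10), then EVERY isomorphism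
`c : μ_Ẑ(Π^tp_{X̲̲}/Δ) ⥲ (l·Δ_Θ)(𝕄_*)` intertwines `μ_Ẑ(quotMap γ)` with `ρ_A(γ)` for EVERY topological automorphism `γ` and
EVERY Ex. 1.8 interface `A` — the hypothesis (C′) of abc-iut-w5-d145's `…_of_compatible`, verbatim.
[claim: Mochizuki2012, status: disputed] (IUTchII §1 Cor 1.11, kurims p.49) -/
theorem compatible_of_hgalois (A : AbsTopMonoids (setting C hC hS hl hp2 hpl hζ mods f hf))
    (c : ↥(A.quotObj (basePointLim C hC hS hl hp2 hpl hζ mods f hf hmods h15 L hZ)).galCyclotome ≃*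
      (baseDatumLim C hC hS hl hp2 hpl hζ mods f hf hmods h15 L hZ (h218i 1)).A)
    (γ : basePointLim C hC hS hl hp2 hpl hζ mods f hf hmods h15 L hZ ⟶ basePointLim C hC hS hl hp2 hpl hζ mods f hf hmods h15 L hZ)
    (ζ : (A.quotObj (basePointLim C hC hS hl hp2 hpl hζ mods f hf hmods h15 L hZ)).galCyclotome) :
    c (IsoClass.galCyclotomeMap (A.quotMap γ) ζ) =
      (baseDatumLim C hC hS hl hp2 hpl hζ mods f hf hmods h15 L hZ (h218i 1)).rhoA (IsoClass.homIso γ) (c ζ) := by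
  obtain ⟨τ, hτ⟩ := hHGAL (IsoClass.homIso γ)
  exact compatible_of_galois C hC hS hl hp2 hpl hζ mods f hf hmods h15 L hZ h218i A γ τ (fun x => hτ x)
    (fun n a => coeffAut_eq_galMuN_of_thetaMod_natural C hC hS hl hp2 hpl hζ mods f hf h15 L h218i n
      (IsoClass.homIso γ) τ
      (fun g hg => thetaMod_natural_of_hgal C hC hS mods hmods h15 L h218i hO hYcl hT hqΘ (IsoClass.homIso γ) τ hτ n g hg) a)
    c ζ

/-! ## The Cor. 1.11 functor with all four inputs genuine, from (HGAL) alone -/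

variable (k : Type) [Field k] [CharZero k] [ValuativeRel k] [TopologicalSpace k] [IsNonarchimedeanLocalField k]
  (ε : (setting C hC hS hl hp2 hpl hζ mods f hf).Gk ≃ₜ*
    (ModelMLFGaloisData.galois (MLFClosure.std k).k (MLFClosure.std k).K).tmPair.Pi)
  (hΔ : ∀ g : (setting C hC hS hl hp2 hpl hζ mods f hf).PiX ≃ₜ* (setting C hC hS hl hp2 hpl hζ mods f hf).PiX,
    (setting C hC hS hl hp2 hpl hζ mods f hf).DeltaX.map g.toMulEquiv.toMonoidHom =
      (setting C hC hS hl hp2 hpl hζ mods f hf).DeltaX)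
  (hq : Nonempty (TopGroup.quot (setting C hC hS hl hp2 hpl hζ mods f hf).PiX
    (setting C hC hS hl hp2 hpl hζ mods f hf).DeltaX ≃ₜ* (setting C hC hS hl hp2 hpl hζ mods f hf).Gk))

include hO hYcl hT hqΘ hHGAL in
/-- **[IUTchII] Cor. 1.11 with ALL inputs GENUINE, from (HGAL) alone** (arbitrary MLF `k` with a model identification `ε` of
`G_K` with `Gal(k̄/k)` of the standard closure): over the [EtTh]-model setting, with the GENUINE monoids `genuineOfModel`, the
GENUINE `Ẑ^×`-twist, the UNCONDITIONAL rigidity input and Cor. 1.10's GENUINE family `familyLim`, the Cor. 1.11 functor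
`ℛ → ℱ` EXISTS and is multiradially defined — granted, beyond the printed side conditions and the class-R origin clauses, (H1)
`hΔ`, (H2) `hq`, F-0620 at every level and (HGAL) = [AbsTopIII] Cor. 1.10 ONLY (abc-iut-w5-d145's `…_of_compatible` with its
hypothesis (C′) DISCHARGED by `compatible_of_hgalois`). [claim: Mochizuki2012, status: disputed] (IUTchII §1 Cor 1.11, kurims p.49) -/
theorem exists_cor111FunctorCor110_familyLim_multiradiallyDefined_of_hgalois
    (Γ : Subgroup ZHatUnits) (Γ' : Type) [Group Γ'] :
    ∃ (R : GalRigidityInput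
        (AbsTopMonoids.genuineOfModel (setting C hC hS hl hp2 hpl hζ mods f hf) (MLFClosure.std k) ε hΔ hq))
      (I : GalCorPiXInput
        (AbsTopMonoids.genuineOfModel (setting C hC hS hl hp2 hpl hζ mods f hf) (MLFClosure.std k) ε hΔ hq)
        (familyLim C hC hS hl hp2 hpl hζ mods f hf hmods h15 L hZ (h218i 1))),
      ((ex18iii (setting C hC hS hl hp2 hpl hζ mods f hf) Γ').toDagger
        (cor111FunctorCor110 (GalTwistInput.ofZHat (setting C hC hS hl hp2 hpl hζ mods f hf)) R
          (familyLim C hC hS hl hp2 hpl hζ mods f hf hmods h15 L hZ (h218i 1)) I Γ Γ')).IsMultiradiallyDefined :=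
  exists_cor111FunctorCor110_familyLim_multiradiallyDefined_of_compatible C hC hS hl hp2 hpl hζ mods f hf hmods h15 L hZ
    (h218i 1) k ε hΔ hq
    (fun c γ ζ => compatible_of_hgalois C hC hS hl hp2 hpl hζ mods f hf hmods h15 L hZ h218i hO hYcl hT hqΘ hHGAL
      (AbsTopMonoids.genuineOfModel (setting C hC hS hl hp2 hpl hζ mods f hf) (MLFClosure.std k) ε hΔ hq) c γ ζ)
    Γ Γ'

include hO hYcl hT hqΘ hHGAL in
/-- **[IUTchII] Cor. 1.11 with ALL inputs GENUINE over the setting's OWN base field `K`, from (HGAL) alone** (`k := K ⊆ ℚ̄_p`,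
`ε := TemperedCurve.galoisEpsilon`; NO model identification left): the Cor. 1.11 functor `ℛ → ℱ` over `genuineOfModel (setting …)
K.mlfClosure K.galoisEpsilon`, the genuine `Ẑ^×`-twist, the unconditional rigidity input and Cor. 1.10's genuine family EXISTS and
is multiradially defined — residual inputs BY NAME: F-0620 (every level), (HGAL), (H1) `hΔ`, (H2) `hq`, `IsQuotientMap toTheta`,
the class-R origin clauses, `Prop15iii`, `hZ`. THE CLOSER OF RECORD for node IUTchII:Cor1.11 under ruling C-R25: instantiate
`hHGAL` with the FACT-LIST id of [AbsTopIII] Cor. 1.10 when it is typed at printed strength.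
[claim: Mochizuki2012, status: disputed] (IUTchII §1 Cor 1.11, kurims p.49) -/
theorem exists_cor111FunctorCor110_familyLim_multiradiallyDefined_of_hgalois_ownField
    (Γ : Subgroup ZHatUnits) (Γ' : Type) [Group Γ'] :
    ∃ (R : GalRigidityInput
        (AbsTopMonoids.genuineOfModel (setting C hC hS hl hp2 hpl hζ mods f hf) D.toTemperedCurve.mlfClosure
          D.toTemperedCurve.galoisEpsilon hΔ hq))
      (I : GalCorPiXInput
        (AbsTopMonoids.genuineOfModel (setting C hC hS hl hp2 hpl hζ mods f hf) D.toTemperedCurve.mlfClosure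
          D.toTemperedCurve.galoisEpsilon hΔ hq)
        (familyLim C hC hS hl hp2 hpl hζ mods f hf hmods h15 L hZ (h218i 1))),
      ((ex18iii (setting C hC hS hl hp2 hpl hζ mods f hf) Γ').toDagger
        (cor111FunctorCor110 (GalTwistInput.ofZHat (setting C hC hS hl hp2 hpl hζ mods f hf)) R
          (familyLim C hC hS hl hp2 hpl hζ mods f hf hmods h15 L hZ (h218i 1)) I Γ Γ')).IsMultiradiallyDefined :=
  exists_cor111FunctorCor110_familyLim_multiradiallyDefined_of_compatible_ownField C hC hS hl hp2 hpl hζ mods f hf hmods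
    h15 L hZ (h218i 1) hΔ hq
    (fun c γ ζ => compatible_of_hgalois C hC hS hl hp2 hpl hζ mods f hf hmods h15 L hZ h218i hO hYcl hT hqΘ hHGAL
      (AbsTopMonoids.genuineOfModel (setting C hC hS hl hp2 hpl hζ mods f hf) D.toTemperedCurve.mlfClosure
        D.toTemperedCurve.galoisEpsilon hΔ hq) c γ ζ)
    Γ Γ'

end EtaleLevels

/-! ## The own-field capstone with the binder `hZ` supplied at the origin -/

namespace EtaleLevels

open Literature.AnabelianGeometry.EtaleTheta Literature.AnabelianGeometry.SemiGraphs
open Literature.AnabelianGeometry.EtaleTheta.ThetaSetting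
open scoped Literature.AnabelianGeometry.EtaleTheta

variable {p : ℕ} [Fact p.Prime] {D : Literature.AnabelianGeometry.EtaleTheta.ThetaSetting p}
  {E : D.EtaleThetaData} {l : ℕ} (C : E.DoubleUnderline l) (hC : D.Compat) (hS : D.Sec2Hyps)
  (hl : l.Prime) (hp2 : p ≠ 2) (hpl : p ≠ l) (hζ : ∃ ζ : D.K, IsPrimitiveRoot ζ (4 * l))
  (mods : ∀ M : ℕ+, D.CyclotomeMod l M)
  (f : contCocycles D.toTheta D.DeltaTheta C.GtpYdduu) (hf : f ∈ C.rootCocycles hC)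
  (hmods : ∀ (M M' : ℕ+) (h : (M : ℕ) ∣ (M' : ℕ)) (x : D.lDeltaTheta l),
    MuN.red p M M' h ((mods M').red x) = (mods M).red x)
  (h15 : Literature.AnabelianGeometry.EtaleTheta.ThetaSetting.Prop15iii E hC) (L : C.CuspLabels)
  (hO : D.IsEtThOrigin)
  (hYcl : (D.DtpY.map D.toHat.toMonoidHom).topologicalClosure ≤
    D.DtpY.map D.toHat.toMonoidHom ⊔ (⁅⁅D.DeltaHat, D.DeltaHat⁆, D.DeltaHat⁆).topologicalClosure)
  (hT : D.IsTateOrigin) (hqΘ : IsQuotientMap D.toTheta)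
  (h218i : ∀ M : ℕ+, (levelRigid C hC hS mods h15 L M).Cor218_i)
  [CompactSpace (setting C hC hS hl hp2 hpl hζ mods f hf).Gk]
  (hΔ : ∀ g : (setting C hC hS hl hp2 hpl hζ mods f hf).PiX ≃ₜ* (setting C hC hS hl hp2 hpl hζ mods f hf).PiX,
    (setting C hC hS hl hp2 hpl hζ mods f hf).DeltaX.map g.toMulEquiv.toMonoidHom =
      (setting C hC hS hl hp2 hpl hζ mods f hf).DeltaX)
  (hq : Nonempty (TopGroup.quot (setting C hC hS hl hp2 hpl hζ mods f hf).PiX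
    (setting C hC hS hl hp2 hpl hζ mods f hf).DeltaX ≃ₜ* (setting C hC hS hl hp2 hpl hζ mods f hf).Gk))
  (hHGAL : ∀ α : (EtaleThetaDataOfSetting.Pi C) ≃ₜ* (EtaleThetaDataOfSetting.Pi C), ∃ τ : GQp p,
    ∀ x : EtaleThetaDataOfSetting.Pi C,
      EtaleThetaDataOfSetting.aug C (α x) = τ * EtaleThetaDataOfSetting.aug C x * τ⁻¹)

include hT hqΘ hHGAL in
/-- **The same over `K`, with `hZ` SUPPLIED**: at an [EtTh] origin the binder `hZ` («(l·Δ_Θ)/thetaKer ≅ Ẑ» at every level,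
G-w4d021-1) IS abc-iut-L2-d1's theorem `ModelCyclotomes.nonempty_lDeltaQuot_rigidData_mulEquiv_zHat … hO hYcl` (p415192), so the
Cor. 1.11 functor over `K` exists and is multiradially defined with the residual list of
`…_of_hgalois_ownField` MINUS `hZ`. [claim: Mochizuki2012, status: disputed] (IUTchII §1 Cor 1.11, kurims p.49) -/
theorem exists_cor111FunctorCor110_familyLim_multiradiallyDefined_of_hgalois_ownField_origin
    (Γ : Subgroup ZHatUnits) (Γ' : Type) [Group Γ'] :
    ∃ (R : GalRigidityInput
        (AbsTopMonoids.genuineOfModel (setting C hC hS hl hp2 hpl hζ mods f hf) D.toTemperedCurve.mlfClosure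
          D.toTemperedCurve.galoisEpsilon hΔ hq))
      (I : GalCorPiXInput
        (AbsTopMonoids.genuineOfModel (setting C hC hS hl hp2 hpl hζ mods f hf) D.toTemperedCurve.mlfClosure
          D.toTemperedCurve.galoisEpsilon hΔ hq)
        (familyLim C hC hS hl hp2 hpl hζ mods f hf hmods h15 L
          (fun M => ModelCyclotomes.nonempty_lDeltaQuot_rigidData_mulEquiv_zHat C (mods M) hC hS h15 L hO hYcl hl.ne_zero)
          (h218i 1))),
      ((ex18iii (setting C hC hS hl hp2 hpl hζ mods f hf) Γ').toDagger
        (cor111FunctorCor110 (GalTwistInput.ofZHat (setting C hC hS hl hp2 hpl hζ mods f hf)) R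
          (familyLim C hC hS hl hp2 hpl hζ mods f hf hmods h15 L
            (fun M => ModelCyclotomes.nonempty_lDeltaQuot_rigidData_mulEquiv_zHat C (mods M) hC hS h15 L hO hYcl hl.ne_zero)
            (h218i 1)) I Γ Γ')).IsMultiradiallyDefined :=
  exists_cor111FunctorCor110_familyLim_multiradiallyDefined_of_hgalois_ownField C hC hS hl hp2 hpl hζ mods f hf hmods h15 L
    (fun M => ModelCyclotomes.nonempty_lDeltaQuot_rigidData_mulEquiv_zHat C (mods M) hC hS h15 L hO hYcl hl.ne_zero)
    h218i hO hYcl hT hqΘ hHGAL hΔ hq Γ Γ'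

end EtaleLevels

end Literature.IUT.HodgeArakelov

end
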